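import Summits.KontsevichZagierPeriods.KontsevichZagierPeriods.Theorems.HeckeMultiplicityOneManinStokesTileInverse

/-!
# `ManinStokes` (stmt-KontsevichZagierPeriods-5277): the edge `B` of the tile in the coordinate `u = j`

Support file (prover-owned, `--supports stmt-KontsevichZagierPeriods-5277`). With `ψ` a right inverse of
`j` on the closed lower half plane (see `…TileInverse.lean`) and `G = (ω/dj) ∘ ψ = djQuot φ ∘ ψ` the
integrand of the per-tile Cauchy relation:

* `deriv_kleinJ_mul_djQuot`, `norm_deriv_kleinJ_mul_djQuot_le` — Ramanujan's identity in product form,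
  `j' · (ω/dj) = 2πi φ`, `‖j'‖ · ‖ω/dj‖ ≤ 2π ‖φ‖`;
* the arc `B`: derivative of `θ ↦ j(e^{iθ})` (real), `image_kleinJ_ofComplex_exp_re_Ioo` (the open arc maps
  onto `(0, 1728)`), `tileInv_kleinJ_ofComplex_exp` (`ψ` on the arc), and
* `integrableOn_djQuot_tileInv_B` — **`G` is absolutely integrable on `(0, 1728)`** for holomorphic `φ`
  (substitution `u = re j(e^{iθ})`, Mathlib's one-variable Jacobian criterion; the substituted integrand has
  norm `≤ 2π ‖φ(e^{iθ})‖`).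

References: M. Kontsevich, D. Zagier, *Periods* (2001), §3.4; J. E. Cremona, *Algorithms for modular
elliptic curves* (1997), §2.10. No definitions, no named facts.
-/

noncomputable section

open scoped MatrixGroups ModularForm Modular Manifold Topology
open CongruenceSubgroup Complex Set Filter MeasureTheory ModularForm
open UpperHalfPlane hiding I
open Literature.NumberTheory.EllipticCurves Literature.NumberTheory.EllipticCurves.ModularForms

namespace Summit.KontsevichZagierPeriods.HeckeMultiplicityOne.ManinStokes






/-! ### The edge `B` in the coordinate `u`: the substitution `u = re j(e^{iθ})` -/

/-- The derivative of `θ ↦ j(e^{iθ})`: `j'(e^{iθ}) · i e^{iθ}`. [folklore] -/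
theorem hasDerivAt_kleinJ_ofComplex_exp {θ : ℝ} (h0 : 0 < θ) (hπ : θ < Real.pi) :
    HasDerivAt (fun s : ℝ => kleinJ (ofComplex (Complex.exp (s * I))))
      (deriv (kleinJ ∘ ofComplex) (Complex.exp (θ * I)) * (Complex.exp (θ * I) * I)) θ := by
  have hd : DifferentiableAt ℂ (kleinJ ∘ ofComplex) (Complex.exp (θ * I)) :=
    differentiableOn_kleinJ.differentiableAt
      (UpperHalfPlane.isOpen_upperHalfPlaneSet.mem_nhds (im_exp_mul_I_pos h0 hπ))
  have h1 : HasDerivAt (fun s : ℝ => Complex.exp (s * I)) (Complex.exp (θ * I) * I) θ := by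
    have h2 : HasDerivAt (fun s : ℝ => (s : ℂ) * I) (1 * I) θ :=
      ((hasDerivAt_id (θ : ℂ)).comp_ofReal).mul_const I
    rw [one_mul] at h2
    exact (Complex.hasDerivAt_exp _).comp θ h2
  exact hd.hasDerivAt.comp θ h1

/-- The derivative of `θ ↦ j(e^{iθ})` is real (the function is real-valued). [folklore] -/
theorem deriv_kleinJ_exp_mul_im {θ : ℝ} (h0 : 0 < θ) (hπ : θ < Real.pi) :
    (deriv (kleinJ ∘ ofComplex) (Complex.exp (θ * I)) * (Complex.exp (θ * I) * I)).im = 0 := by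
  have him : HasDerivAt (fun s : ℝ => (kleinJ (ofComplex (Complex.exp (s * I)))).im)
      (deriv (kleinJ ∘ ofComplex) (Complex.exp (θ * I)) * (Complex.exp (θ * I) * I)).im θ :=
    (Complex.imCLM.hasFDerivAt).comp_hasDerivAt θ (hasDerivAt_kleinJ_ofComplex_exp h0 hπ)
  have h0' : HasDerivAt (fun s : ℝ => (kleinJ (ofComplex (Complex.exp (s * I)))).im) 0 θ := by
    refine (hasDerivAt_const θ (0 : ℝ)).congr_of_eventuallyEq ?_
    filter_upwards [isOpen_Ioo.mem_nhds (show θ ∈ Ioo 0 Real.pi from ⟨h0, hπ⟩)] with s hs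
    exact kleinJ_ofComplex_exp_im hs.1 hs.2
  exact him.unique h0'

/-- `θ ↦ re j(e^{iθ})` has derivative `re (j'(e^{iθ}) i e^{iθ})`. [folklore] -/
theorem hasDerivAt_kleinJ_ofComplex_exp_re {θ : ℝ} (h0 : 0 < θ) (hπ : θ < Real.pi) :
    HasDerivAt (fun s : ℝ => (kleinJ (ofComplex (Complex.exp (s * I)))).re)
      (deriv (kleinJ ∘ ofComplex) (Complex.exp (θ * I)) * (Complex.exp (θ * I) * I)).re θ :=
  (Complex.reCLM.hasFDerivAt).comp_hasDerivAt θ (hasDerivAt_kleinJ_ofComplex_exp h0 hπ)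

/-- The real derivative along the arc has the same size as the complex one:
`|re (j'(e^{iθ}) i e^{iθ})| = ‖j'(e^{iθ})‖`. [folklore] -/
theorem abs_deriv_kleinJ_exp_re {θ : ℝ} (h0 : 0 < θ) (hπ : θ < Real.pi) :
    |(deriv (kleinJ ∘ ofComplex) (Complex.exp (θ * I)) * (Complex.exp (θ * I) * I)).re| =
      ‖deriv (kleinJ ∘ ofComplex) (Complex.exp (θ * I))‖ := by
  set w := deriv (kleinJ ∘ ofComplex) (Complex.exp (θ * I)) * (Complex.exp (θ * I) * I) with hw
  have him := deriv_kleinJ_exp_mul_im h0 hπ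
  have hw' : w = ((w.re : ℝ) : ℂ) := Complex.ext (by simp) (by rw [Complex.ofReal_im, hw, him])
  have h1 : |w.re| = ‖w‖ := by
    conv_rhs => rw [hw']
    rw [Complex.norm_real, Real.norm_eq_abs]
  rw [h1, hw, norm_mul, norm_mul, Complex.norm_exp_ofReal_mul_I, Complex.norm_I]; ring

/-- **The open arc maps onto `(0, 1728)`**: `re j(e^{iθ})`, `π/3 < θ < π/2`, takes every value in
`(0, 1728)` exactly once. [folklore] -/
theorem image_kleinJ_ofComplex_exp_re_Ioo :
    (fun θ : ℝ => (kleinJ (ofComplex (Complex.exp (θ * I)))).re) '' Ioo (Real.pi / 3) (Real.pi / 2) =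
      Ioo 0 1728 := by
  have hmono := strictMonoOn_kleinJ_ofComplex_exp_re
  have hπ := Real.pi_pos
  ext u
  constructor
  · rintro ⟨θ, hθ, rfl⟩
    constructor
    · rw [← kleinJ_exp_pi_div_three_re]
      exact hmono ⟨le_rfl, by linarith⟩ ⟨hθ.1.le, hθ.2.le⟩ hθ.1
    · rw [← kleinJ_exp_pi_div_two_re]
      exact hmono ⟨hθ.1.le, hθ.2.le⟩ ⟨by linarith, le_rfl⟩ hθ.2
  · intro hu
    obtain ⟨θ, hθ, hθu⟩ := exists_kleinJ_ofComplex_exp_re_eq ⟨hu.1.le, hu.2.le⟩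
    refine ⟨θ, ⟨hθ.1.lt_of_ne ?_, hθ.2.lt_of_ne ?_⟩, hθu⟩
    · rintro rfl; rw [kleinJ_exp_pi_div_three_re] at hθu; exact hu.1.ne hθu
    · rintro rfl; rw [kleinJ_exp_pi_div_two_re] at hθu; exact hu.2.ne' hθu

/-- `j(e^{iθ})` equals the real number `re j(e^{iθ})`. [folklore] -/
theorem kleinJ_ofComplex_exp_eq_re {θ : ℝ} (h0 : 0 < θ) (hπ : θ < Real.pi) :
    kleinJ (ofComplex (Complex.exp (θ * I))) = ((kleinJ (ofComplex (Complex.exp (θ * I)))).re : ℂ) :=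
  Complex.ext (by simp) (by rw [Complex.ofReal_im, kleinJ_ofComplex_exp_im h0 hπ])

/-- The inverse `ψ` at the points of the open arc: `ψ (re j(e^{iθ})) = e^{iθ}`. [folklore] -/
theorem tileInv_kleinJ_ofComplex_exp {ψ : ℂ → ℍ}
    (hψ : ∀ u : ℂ, u.im ≤ 0 → ψ u ∈ {z : ℍ | z ∈ 𝒟 ∧ 0 ≤ z.re} ∧ kleinJ (ψ u) = u)
    {θ : ℝ} (hθ : θ ∈ Icc (Real.pi / 3) (Real.pi / 2)) :
    ψ ((kleinJ (ofComplex (Complex.exp (θ * I)))).re : ℂ) = ofComplex (Complex.exp (θ * I)) := by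
  obtain ⟨h0, hπ⟩ := pos_and_lt_pi_of_mem_Icc hθ
  rw [← kleinJ_ofComplex_exp_eq_re h0 hπ]
  exact tileInv_kleinJ hψ (ofComplex_exp_mem_halfFd hθ)

/-- **Integrability of the `B`-edge integrand** `u ↦ djQuot φ (ψ u)` on `(0, 1728)` for holomorphic `φ`:
after the substitution `u = re j(e^{iθ})` (rule (2) value level, Mathlib's one-variable Jacobian
criterion) the integrand is `|du/dθ| · (ω/dj)(e^{iθ})`, of norm `≤ 2π ‖φ(e^{iθ})‖`, bounded on the compact
arc. [folklore] -/
theorem integrableOn_djQuot_tileInv_B {ψ : ℂ → ℍ}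
    (hψ : ∀ u : ℂ, u.im ≤ 0 → ψ u ∈ {z : ℍ | z ∈ 𝒟 ∧ 0 ≤ z.re} ∧ kleinJ (ψ u) = u)
    {φ : ℍ → ℂ} (hφ : MDifferentiable 𝓘(ℂ) 𝓘(ℂ) φ) :
    IntegrableOn (fun x : Fin 1 → ℝ => djQuot φ (ψ (x 0))) {x | x 0 ∈ Ioo (0 : ℝ) 1728} := by
  rw [integrableOn_fin1_iff (fun u : ℝ => djQuot φ (ψ u)), ← image_kleinJ_ofComplex_exp_re_Ioo]
  have hπ := Real.pi_pos
  have hsub : Ioo (Real.pi / 3) (Real.pi / 2) ⊆ Ioo 0 Real.pi := fun θ hθ =>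
    ⟨by linarith [hθ.1], by linarith [hθ.2]⟩
  rw [integrableOn_image_iff_integrableOn_abs_deriv_smul measurableSet_Ioo
    (fun θ hθ => (hasDerivAt_kleinJ_ofComplex_exp_re (hsub hθ).1 (hsub hθ).2).hasDerivWithinAt)
    (injOn_kleinJ_ofComplex_exp_re.mono Ioo_subset_Icc_self)]
  -- the substituted integrand and its continuous bound
  have hcongr : EqOn
      (fun θ : ℝ => |(deriv (kleinJ ∘ ofComplex) (Complex.exp (θ * I)) * (Complex.exp (θ * I) * I)).re| •
        djQuot φ (ψ (((kleinJ (ofComplex (Complex.exp (θ * I)))).re : ℝ) : ℂ)))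
      (fun θ : ℝ => |(deriv (kleinJ ∘ ofComplex) (Complex.exp (θ * I)) * (Complex.exp (θ * I) * I)).re| •
        djQuot φ (ofComplex (Complex.exp (θ * I)))) (Ioo (Real.pi / 3) (Real.pi / 2)) := by
    intro θ hθ
    simp only
    rw [tileInv_kleinJ_ofComplex_exp hψ (Ioo_subset_Icc_self hθ)]
  rw [integrableOn_congr_fun hcongr measurableSet_Ioo]
  -- continuity of the substituted integrand on the open arc
  have h1 : ContinuousOn (kleinJ ∘ ofComplex) {z : ℂ | 0 < z.im} :=
    (UpperHalfPlane.mdifferentiable_iff.mp mdifferentiable_kleinJ).continuousOn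
  have hexp : ∀ θ ∈ Ioo (Real.pi / 3) (Real.pi / 2), 0 < (Complex.exp (θ * I)).im := fun θ hθ =>
    im_exp_mul_I_pos (hsub hθ).1 (hsub hθ).2
  have hφc : ContinuousOn (fun θ : ℝ => φ (ofComplex (Complex.exp (θ * I)))) (Icc (Real.pi / 3) (Real.pi / 2)) := by
    have h2 : ContinuousOn (φ ∘ ofComplex) {z : ℂ | 0 < z.im} :=
      (UpperHalfPlane.mdifferentiable_iff.mp hφ).continuousOn
    refine h2.comp (by fun_prop) fun θ hθ => ?_
    obtain ⟨h0, hπ'⟩ := pos_and_lt_pi_of_mem_Icc hθ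
    exact im_exp_mul_I_pos h0 hπ'
  obtain ⟨C, hC⟩ := (isCompact_Icc.image_of_continuousOn hφc).isBounded.exists_norm_le
  have hderiv_cont : ContinuousOn (fun θ : ℝ =>
      |(deriv (kleinJ ∘ ofComplex) (Complex.exp (θ * I)) * (Complex.exp (θ * I) * I)).re|)
      (Ioo (Real.pi / 3) (Real.pi / 2)) := by
    have hd : ContinuousOn (deriv (kleinJ ∘ ofComplex)) {z : ℂ | 0 < z.im} :=
      (differentiableOn_kleinJ.deriv UpperHalfPlane.isOpen_upperHalfPlaneSet).continuousOn
    refine (continuous_abs.comp_continuousOn (Complex.continuous_re.comp_continuousOn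
      ((hd.comp (by fun_prop) hexp).mul (by fun_prop))))
  have hE : ∀ θ ∈ Ioo (Real.pi / 3) (Real.pi / 2),
      E₄ (ofComplex (Complex.exp (θ * I))) ≠ 0 ∧ E₆ (ofComplex (Complex.exp (θ * I))) ≠ 0 := by
    intro θ hθ
    have hu : (kleinJ (ofComplex (Complex.exp (θ * I)))).re ∈ Ioo (0 : ℝ) 1728 := by
      rw [← image_kleinJ_ofComplex_exp_re_Ioo]; exact ⟨θ, hθ, rfl⟩
    have hj := kleinJ_ofComplex_exp_eq_re (hsub hθ).1 (hsub hθ).2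
    constructor
    · intro h
      obtain ⟨γ, hγ⟩ := E₄_eq_zero_iff.mp h
      have : kleinJ (ofComplex (Complex.exp (θ * I))) = 0 := by rw [← hγ, kleinJ_smul, kleinJ_rho]
      rw [hj] at this
      exact hu.1.ne' (by exact_mod_cast this)
    · intro h
      obtain ⟨γ, hγ⟩ := E₆_eq_zero_iff.mp h
      have : kleinJ (ofComplex (Complex.exp (θ * I))) = 1728 := by rw [← hγ, kleinJ_smul, kleinJ_I]
      rw [hj] at this
      exact hu.2.ne (by exact_mod_cast this)
  have hdj : ContinuousOn (fun θ : ℝ => djQuot φ (ofComplex (Complex.exp (θ * I))))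
      (Ioo (Real.pi / 3) (Real.pi / 2)) := by
    have hφc' := hφc.mono Ioo_subset_Icc_self
    have h4 : ContinuousOn (fun θ : ℝ => E₄ (ofComplex (Complex.exp (θ * I)))) (Ioo (Real.pi / 3) (Real.pi / 2)) :=
      ((UpperHalfPlane.mdifferentiable_iff.mp (E₄ : ModularForm 𝒮ℒ 4).holo').continuousOn).comp
        (by fun_prop) hexp
    have h6 : ContinuousOn (fun θ : ℝ => E₆ (ofComplex (Complex.exp (θ * I)))) (Ioo (Real.pi / 3) (Real.pi / 2)) :=
      ((UpperHalfPlane.mdifferentiable_iff.mp (E₆ : ModularForm 𝒮ℒ 6).holo').continuousOn).comp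
        (by fun_prop) hexp
    have hΔ : ContinuousOn (fun θ : ℝ => ModularForm.discriminant (ofComplex (Complex.exp (θ * I))))
        (Ioo (Real.pi / 3) (Real.pi / 2)) :=
      ((UpperHalfPlane.mdifferentiable_iff.mp CuspForm.discriminant.holo').continuousOn).comp
        (by fun_prop) hexp
    simp only [djQuot]
    refine ((hφc'.mul hΔ).neg).div ((h4.pow 2).mul h6) fun θ hθ => ?_
    exact mul_ne_zero (pow_ne_zero _ (hE θ hθ).1) (hE θ hθ).2
  have hcont : ContinuousOn (fun θ : ℝ =>
      |(deriv (kleinJ ∘ ofComplex) (Complex.exp (θ * I)) * (Complex.exp (θ * I) * I)).re| •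
        djQuot φ (ofComplex (Complex.exp (θ * I)))) (Ioo (Real.pi / 3) (Real.pi / 2)) :=
    hderiv_cont.smul hdj
  refine Integrable.mono' (g := fun _ => 2 * Real.pi * C)
    ((continuous_const.continuousOn.integrableOn_compact isCompact_Icc).mono_set Ioo_subset_Icc_self)
    (hcont.aestronglyMeasurable measurableSet_Ioo) ?_
  rw [ae_restrict_iff' measurableSet_Ioo]
  refine Eventually.of_forall fun θ hθ => ?_
  rw [norm_smul, Real.norm_eq_abs, abs_abs, abs_deriv_kleinJ_exp_re (hsub hθ).1 (hsub hθ).2]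
  have key := norm_deriv_kleinJ_mul_djQuot_le (ofComplex (Complex.exp (θ * I))) φ
  rw [coe_ofComplex (im_exp_mul_I_pos (hsub hθ).1 (hsub hθ).2)] at key
  refine key.trans ?_
  have := hC _ ⟨θ, Ioo_subset_Icc_self hθ, rfl⟩
  nlinarith [Real.pi_pos, norm_nonneg (φ (ofComplex (Complex.exp (θ * I))))]


end Summit.KontsevichZagierPeriods.HeckeMultiplicityOne.ManinStokes
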